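import Literature.AlgebraicGeometry.HodgeTheory.HodgeClassesCupPairing
import Literature.AlgebraicGeometry.HodgeTheory.HodgeSectionRestrictionTriangulable
import Literature.AlgebraicGeometry.HodgeTheory.HodgeSectionRestrictionGysinKernel
import HarnessLib

/-!
# Hodge classes restrict non-trivially to hypersurface sections: BFNP Lemma 50 from named facts of the tree only (proved glue)

Family `hodge`, layer `Literature/AlgebraicGeometry/HodgeTheory`. Fifth companion of the named fact
`hodgeSectionRestriction_of_hodgeConjectureFor` (file `HodgeSectionRestriction`; P. Brosnan,
H. Fang, Z. Nie, G. Pearlstein, *Singularities of admissible normal functions*, Invent. Math. 177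
(2009), §6 Lemma 50 with Lemma 49; arXiv:0711.0964 p. 13). The printed proof has three inputs:

* (P) "By Poincaré duality and the Hodge–Riemann relations, there exists a class `α ∈ Hdg^{2n}(X)`
  such that `0 ≠ α ∪ ζ`" — the perfect pairing (6.1) on Hodge classes, now the tree's named fact
  `hodgeClasses_cupPairing_nondegenerate d X` (file `HodgeClassesCupPairing`; its middle-degree
  case `hodgeClasses_cupPairing_nondegenerate.middle` is verbatim the hypothesis `hPair` of the
  earlier reductions);
* (H) "By the Hodge conjecture for `X`, we can write `α = Σ aᵢ [Zᵢ]`" — the hypothesis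
  `HodgeConjectureFor (2 * n) X` of the fact itself;
* (C)+(L49) "`ζ ∪ [Zᵢ] ≠ 0` for some index `i`. Equivalently, `0 ≠ ζ|_{Zᵢ}` … The lemma then follows
  from Lemma 49" — PROVED in the tree by two independent routes, each relative to named facts:
  the local contractibility of complex projective algebraic sets from the semialgebraic
  `C¹`-triangulation theorem `OhmotoShiota2017_c1Triangulation`
  (`hodgeSectionRestriction_of_hodgeConjectureFor_of_pairing_of_c1Triangulation`, file
  `HodgeSectionRestrictionTriangulable`), or Deligne's description of the classes dying off a
  Zariski-closed subset `Deligne1974_ker_restrictCompl_eq_iSup_range_complexGysin` (Hodge III,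
  Cor. 8.2.8) with resolutions `Resolution.Hironaka1964_projective` and the proved projection
  formula (`hodgeSectionRestriction_of_hodgeConjectureFor_of_pairing_of_gysinKernel`, file
  `HodgeSectionRestrictionGysinKernel`); Lemma 49 is proved (`exists_forall_le_form_vanishing_of_notMem`,
  file `HodgeSectionRestrictionProofs`).

This file records the resulting glue, in which EVERY hypothesis is a named fact of the tree (no
free hypothesis remains): `hodgeSectionRestriction_of_hodgeConjectureFor` follows from
`hodgeClasses_cupPairing_nondegenerate` (all `(d, X)`; only `d` even, middle degree is used) and
EITHER `OhmotoShiota2017_c1Triangulation` OR (`Deligne1974_ker_restrictCompl_eq_iSup_range_complexGysin`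
and `Resolution.Hironaka1964_projective`); together with the per-variety forms (the fact for one
`2n`-fold `X` from (6.1) for that `X`), the fourfold case (the statement of the landing pad
`Summit.HodgeConjecture.HodgeConjecture.Theses.HeightMassDefect.SectionRestrictionFourfold` for
`X`), and the all-large-degrees form of the Gysin route. The discharge
`hodgeSectionRestriction_of_hodgeConjectureFor_holds` is then the one-liner
`…_of_cupPairing_of_c1Triangulation (fun d X ↦ hodgeClasses_cupPairing_nondegenerate_holds d X) OhmotoShiota2017_c1Triangulation_holds`
(or the Gysin variant) as soon as those named facts are discharged; none is, at the time of writing.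

## References

* [BrosnanFangNiePearlstein2009] P. Brosnan, H. Fang, Z. Nie, G. Pearlstein, Singularities of
  admissible normal functions, Invent. Math. 177 (2009) 599–629, §6 (6.1), Lemmas 49–50
  (arXiv:0711.0964, p. 13).
* [VoisinHodgeI2002] C. Voisin, Hodge Theory and Complex Algebraic Geometry I (CUP 2002), §7.1.2,
  Thm. 6.25, Thm. 6.32.
* [OhmotoShiota2017] T. Ohmoto, M. Shiota, `C¹`-triangulations of semialgebraic sets, J. Topol. 10
  (2017), Thm. 1.1.
* [DeligneHodgeIII1974] P. Deligne, Théorie de Hodge III, Publ. Math. IHÉS 44 (1974), Cor. 8.2.8.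
* [Kollar2007] J. Kollár, Lectures on Resolution of Singularities (2007), Thm. 3.27. [Hironaka1964]
-/

noncomputable section

open AlgebraicGeometry
open scoped ContinuousMap

namespace Literature.AlgebraicGeometry.HodgeTheory

section HodgeTheory

open Literature.AlgebraicTopology.SingularHomology Literature.ModelTheory.ExponentialFields

variable {n : ℕ} {X : Motives.SchemeOver ℂ}

/-! ### The triangulation route -/

/-- **BFNP Lemma 50 for one `2n`-fold from (6.1) for it, the Hodge conjecture for it, and the
triangulation theorem**: for `X` smooth projective of dimension `2n ≥ 2` satisfying
`HodgeConjectureFor (2n) X` and the perfect pairing `hodgeClasses_cupPairing_nondegenerate (2n) X`,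
granted `OhmotoShiota2017_c1Triangulation`, every non-zero rational `(n,n)`-class restricts
non-trivially to some hypersurface section `X ∩ V₊(F)`, `deg F ≥ 1`, `F ∉ I(X)`.
[cite: BrosnanFangNiePearlstein2009, §6 (6.1) and Lemma 50] [cite: OhmotoShiota2017, Thm. 1.1] -/
theorem exists_sectionRestriction_ne_zero_of_cupPairing_of_c1Triangulation (hn : 0 < n)
    (hX : Motives.IsSmoothProjective (2 * n) X) (hHC : HodgeConjectureFor (2 * n) X)
    (hP : hodgeClasses_cupPairing_nondegenerate (2 * n) X)
    (hOS : OhmotoShiota2017_c1Triangulation) (e : Motives.ProjectiveEmbedding X)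
    (c : complexBetti X (2 * n)) (hc : IsRationalClass c)
    (hH : IsOfHodgeType (2 * n) X (2 * n) n n c) (hne : c ≠ 0) :
    ∃ (k : ℕ) (F : MvPolynomial (Fin (e.n + 1)) ℂ) (Z : Set X.left), 0 < k ∧ F.IsHomogeneous k ∧
      Z = e.ι.left.base ⁻¹' (letI := MvPolynomial.gradedAlgebra (σ := Fin (e.n + 1)) (R := ℂ);
        ProjectiveSpectrum.zeroLocus (MvPolynomial.homogeneousSubmodule (Fin (e.n + 1)) ℂ) {F}) ∧
      Z ≠ Set.univ ∧
      singularCohomology.map ℂ ℂ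
        (⟨Subtype.val, continuous_subtype_val⟩ :
          C({P : Motives.ComplexPoints X // P.pt ∈ Z}, Motives.ComplexPoints X)) (2 * n) c ≠ 0 :=
  exists_sectionRestriction_ne_zero_of_pairing_of_locallyContractible hn hX hHC
    (fun c hc hH hne ↦ hP.middle hX c hc hH hne)
    (locallyContractibleSpace_complexPoints_of_isSmoothProjective_of_c1Triangulation hOS hX)
    e c hc hH hne

/-- **The named fact `hodgeSectionRestriction_of_hodgeConjectureFor` (BFNP Lemma 50) from two named
facts of the tree: the perfect pairing on Hodge classes (6.1) and the semialgebraic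
`C¹`-triangulation theorem.** [cite: BrosnanFangNiePearlstein2009, §6 (6.1) and Lemma 50]
[cite: OhmotoShiota2017, Thm. 1.1] -/
theorem hodgeSectionRestriction_of_hodgeConjectureFor_of_cupPairing_of_c1Triangulation
    (hP : ∀ (d : ℕ) (X : Motives.SchemeOver ℂ), hodgeClasses_cupPairing_nondegenerate d X)
    (hOS : OhmotoShiota2017_c1Triangulation) :
    hodgeSectionRestriction_of_hodgeConjectureFor :=
  hodgeSectionRestriction_of_hodgeConjectureFor_of_pairing_of_c1Triangulation
    (pairing_of_hodgeClasses_cupPairing_nondegenerate hP) hOS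

/-- **The fourfold case for one `X`** (the statement of the landing pad
`Summit.HodgeConjecture.HodgeConjecture.Theses.HeightMassDefect.SectionRestrictionFourfold` for `X`):
for a smooth projective fourfold `X` satisfying the Hodge conjecture and the perfect pairing (6.1)
in degree `4`, granted the triangulation theorem, every non-zero rational `(2,2)`-class restricts
non-trivially to some hypersurface section. [cite: BrosnanFangNiePearlstein2009, §6 (6.1) and Lemma 50]
[cite: OhmotoShiota2017, Thm. 1.1] -/
theorem sectionRestriction_fourfold_of_cupPairing_of_c1Triangulation
    (hX : Motives.IsSmoothProjective 4 X) (hHC : HodgeConjectureFor 4 X)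
    (hP : hodgeClasses_cupPairing_nondegenerate 4 X) (hOS : OhmotoShiota2017_c1Triangulation)
    (e : Motives.ProjectiveEmbedding X) (c : complexBetti X 4) (hc : IsRationalClass c)
    (h22 : IsOfHodgeType 4 X 4 2 2 c) (hne : c ≠ 0) :
    ∃ (k : ℕ) (F : MvPolynomial (Fin (e.n + 1)) ℂ) (Z : Set X.left), 0 < k ∧ F.IsHomogeneous k ∧
      Z = e.ι.left.base ⁻¹' (letI := MvPolynomial.gradedAlgebra (σ := Fin (e.n + 1)) (R := ℂ);
        ProjectiveSpectrum.zeroLocus (MvPolynomial.homogeneousSubmodule (Fin (e.n + 1)) ℂ) {F}) ∧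
      Z ≠ Set.univ ∧
      singularCohomology.map ℂ ℂ
        (⟨Subtype.val, continuous_subtype_val⟩ :
          C({P : Motives.ComplexPoints X // P.pt ∈ Z}, Motives.ComplexPoints X)) 4 c ≠ 0 :=
  exists_sectionRestriction_ne_zero_of_cupPairing_of_c1Triangulation (n := 2) two_pos hX hHC hP hOS
    e c hc h22 hne

/-! ### The Gysin route (Deligne, Hodge III, Cor. 8.2.8 + resolutions) -/

/-- **BFNP Lemma 50 for one `2n`-fold, all large degrees, from (6.1) for it, the Hodge conjecture
for it, Deligne's Cor. 8.2.8 and Hironaka's theorem**: there is `k₀ ≥ 1` such that for EVERY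
`k ≥ k₀` the non-zero rational `(n,n)`-class `c` restricts non-trivially to some hypersurface
section of degree `k` (Lemma 49 gives the divisor through `Zᵢ` in all large degrees).
[cite: BrosnanFangNiePearlstein2009, §6 (6.1), Lemma 49 and Lemma 50]
[cite: DeligneHodgeIII1974, Cor. 8.2.8] [cite: Kollar2007, Thm. 3.27] -/
theorem forall_le_exists_sectionRestriction_ne_zero_of_cupPairing_of_gysinKernel
    (hA : Deligne1974_ker_restrictCompl_eq_iSup_range_complexGysin)
    (hH : Resolution.Hironaka1964_projective.{0}) (hn : 0 < n)
    (hX : Motives.IsSmoothProjective (2 * n) X) (hHC : HodgeConjectureFor (2 * n) X)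
    (hP : hodgeClasses_cupPairing_nondegenerate (2 * n) X)
    (e : Motives.ProjectiveEmbedding X) (c : complexBetti X (2 * n)) (hc : IsRationalClass c)
    (hHt : IsOfHodgeType (2 * n) X (2 * n) n n c) (hne : c ≠ 0) :
    ∃ k₀ : ℕ, 0 < k₀ ∧ ∀ k : ℕ, k₀ ≤ k →
      ∃ (F : MvPolynomial (Fin (e.n + 1)) ℂ) (Z : Set X.left), F.IsHomogeneous k ∧
        Z = e.ι.left.base ⁻¹' (letI := MvPolynomial.gradedAlgebra (σ := Fin (e.n + 1)) (R := ℂ);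
          ProjectiveSpectrum.zeroLocus (MvPolynomial.homogeneousSubmodule (Fin (e.n + 1)) ℂ) {F}) ∧
        Z ≠ Set.univ ∧
        singularCohomology.map ℂ ℂ
          (⟨Subtype.val, continuous_subtype_val⟩ :
            C({P : Motives.ComplexPoints X // P.pt ∈ Z}, Motives.ComplexPoints X)) (2 * n) c ≠ 0 :=
  forall_le_exists_sectionRestriction_ne_zero_of_pairing_of_gysinKernel hA hH hn hX hHC
    (fun c hc hH hne ↦ hP.middle hX c hc hH hne) e c hc hHt hne

/-- **The named fact `hodgeSectionRestriction_of_hodgeConjectureFor` (BFNP Lemma 50) from three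
named facts of the tree: the perfect pairing on Hodge classes (6.1), Deligne's Cor. 8.2.8 and
Hironaka's resolution of singularities.** [cite: BrosnanFangNiePearlstein2009, §6 (6.1) and Lemma 50]
[cite: DeligneHodgeIII1974, Cor. 8.2.8] [cite: Kollar2007, Thm. 3.27] -/
theorem hodgeSectionRestriction_of_hodgeConjectureFor_of_cupPairing_of_gysinKernel
    (hP : ∀ (d : ℕ) (X : Motives.SchemeOver ℂ), hodgeClasses_cupPairing_nondegenerate d X)
    (hA : Deligne1974_ker_restrictCompl_eq_iSup_range_complexGysin)
    (hH : Resolution.Hironaka1964_projective.{0}) :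
    hodgeSectionRestriction_of_hodgeConjectureFor :=
  hodgeSectionRestriction_of_hodgeConjectureFor_of_pairing_of_gysinKernel
    (pairing_of_hodgeClasses_cupPairing_nondegenerate hP) hA hH

end HodgeTheory

end Literature.AlgebraicGeometry.HodgeTheory

end
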